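import Summits.SmoothPoincare4.SmoothPoincare4.Theorems.ConvexBisectionContractibleTwistedDoubleStandardStubSeam
import Summits.SmoothPoincare4.SmoothPoincare4.Theorems.ConvexBisectionAcyclicBisectionRigiditySeamGluing
import Literature.Barriers.SmoothPoincare4.ExoticContractibleSymmetryKillingCore
import Literature.Geometry.Symplectic.SteinOrientation
import Literature.Geometry.Symplectic.SteinDomainShrinking
import Literature.Geometry.Symplectic.SteinBoundaryContactProofs
import Literature.Topology.FourManifolds.HeegaardSplittingRealizationProofs
import Literature.Topology.FourManifolds.MorseBirthInsertion
import Literature.Topology.FourManifolds.SphereGenusSplitting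
import Literature.Topology.FourManifolds.ImmersionOrientation
import Literature.Topology.FourManifolds.SPC4HandleChainProofs
import Literature.Topology.FourManifolds.SpinDiffeomorphProofs
import Literature.Topology.FourManifolds.GluingProofs
import Literature.Topology.FourManifolds.RegularLevelSplitting
import Literature.Topology.FourManifolds.MorseProofs
import Literature.Topology.FourManifolds.Cobordism
import HarnessLib

/-!
# The ball sectors of crux `ConvexBisection.ContractibleTwistedDoubleStandard`, Morse-theoretic half
(stub `stub_ballSectorMorse` of line `property-r-mazur-halves`, item stmt-SmoothPoincare4-3546)

**Theorem** (`stub_ballSectorMorse`).  Let the closed smooth `4`-manifold `X` be a Stein bisection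
`X = e₁(W₁) ∪ e₂(W₂)` of two compact contractible Stein domains along a common contact seam (the six
hypotheses of the crux).  If `W₁` is of BALL TYPE — it carries a Morse function adapted to the boundary
with at most one critical point — and `W₂` is SMOOTHLY SMALL — ball type, or Mazur type: an adapted
Morse function with indices `≤ 2` and exactly one critical point of each index `0, 1, 2` — then `X` is
orientable and carries a Morse function with exactly `1, 0, 1, 1, 1` critical points of index
`0, 1, 2, 3, 4`.  (The landed `stub_closedOneZeroOne` then gives `X ≅ S⁴` from Property R and
Laudenbach–Poénaru; so the ball sectors of the crux no longer pass through Eliashberg's filling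
theorem or Cerf's `Γ₄ = 0`.)

Proof.  (1) The unique critical point of the ball-type function `f₁` is an interior minimum, of index
`0` (the interior is nonempty: the minimum of the `J`-convex function lies in it; Fermat at an interior
point, `isMCriticalPt_of_isLocalMin`; `morseIndex_eq_zero_of_isLocalMin_of_isInteriorPoint`), so `f₁`
has profile `(1,0,0,0,0)`; likewise for `f₂` in the ball case.  (2) The seam diffeomorphism
`ψ : ∂W₁ ≅ ∂W₂` of the landed `stub_seam` presents `X` as the boundary gluing `W₁ ∪_ψ W₂`
(`SeamGluing.isBoundaryGluing_of_bisection`), so the landed MORSE GLUING ACROSS THE SEAM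
(`SeamGluing.exists_isMorse_of_bisection`, Milnor 1965 §1) gives a Morse function on `X` with
`#Crit_i = c_i(f₁) + c_{4-i}(f₂)`: profile `(1,0,1,1,1)` when `W₂` is of Mazur type, `(1,0,0,0,1)`
when it is a ball; in the latter case insert one birth pair of indices `2, 3`
(`IsMorse.exists_insert_birthPair`, Milnor 1965 Lemma 8.2) at a regular point (which exists: the
critical set is finite and `X`, a connected Hausdorff space with two points, is infinite).
(3) `X` is orientable: the boundary of the compact contractible `W₁` is connected
(`connectedSpace_boundaryCarrier_of_contractibleSpace`, Lefschetz duality mod 2), the halves are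
orientable (complex orientation, `SteinStructure.isOrientable`), so the model gluing `W₁ ∪_ψ W₂` is
orientable (`exists_isBoundaryGluingWith_connected_isOrientable`, Hirsch 4.4) and `X` is diffeomorphic
to it (uniqueness of gluings, `nonempty_diffeomorph_of_isBoundaryGluing_holds`, Hirsch 8.2.1).

References: J. Milnor, *Lectures on the h-cobordism theorem* (1965), §1, Lemma 8.2; J. Milnor, *Morse
theory* (1963), §2–3; M. W. Hirsch, *Differential Topology* (1976), Ch. 4 §4, Ch. 8 §2 Thm. 2.1;
A. Hatcher, *Algebraic Topology* (2002), Thm. 3.43.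
-/

noncomputable section

-- the prescribed namespace `Summit.<P>.<Sub>.…` duplicates `SmoothPoincare4` (P = Sub)
set_option linter.dupNamespace false

open scoped Manifold ContDiff Topology
open Set Function Literature.Topology.FourManifolds Literature.Geometry.Symplectic

namespace Summit.SmoothPoincare4.SmoothPoincare4.Theorems.ContractibleTwistedDoubleStandard.PropertyRMazurHalves

/-! ### Profile of a ball-type adapted Morse function on a Stein domain -/

/-- **The minimum of the `J`-convex function of a nonempty Stein domain is an interior point**:
otherwise `φ` is constant, so `dφ = 0` at a boundary point, against the regularity axiom
(`SteinStructure.regular`). [folklore] -/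
theorem isInteriorPoint_of_isMinOn_steinφ {W : Type*} [TopologicalSpace W]
    [ChartedSpace (EuclideanHalfSpace 4) W] [IsManifold (𝓡∂ 4) ∞ W] [CompactSpace W]
    (S : SteinStructure W) {p : W} (hp : IsMinOn S.φ univ p) :
    (𝓡∂ 4).IsInteriorPoint p := by
  refine (S.isInteriorPoint_iff_φ_lt p).2 ?_
  by_contra hge
  have hpeq : S.φ p = sSup (range S.φ) := le_antisymm (S.φ_le_sSup p) (not_lt.1 hge)
  have hconst : ∀ y, S.φ y = sSup (range S.φ) := fun y =>
    le_antisymm (S.φ_le_sSup y) (hpeq.ge.trans (hp (mem_univ y)))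
  have hpb : (𝓡∂ 4).IsBoundaryPoint p := (S.boundary_eq p).2 hpeq
  refine S.regular p hpb ?_
  have hfun : S.φ = fun _ => sSup (range S.φ) := funext hconst
  rw [hfun]
  exact mfderiv_const

/-- **A ball-type adapted Morse function on a compact Stein domain has profile `(1,0,0,…)`.**
If `f` is a Morse function adapted to the boundary of the compact nonempty Stein domain `W` with
at most one critical point, then `f` has exactly one critical point of index `0` and none of index
`k ≥ 1`: the interior is nonempty (`isInteriorPoint_of_isMinOn_steinφ`), `f < 1` there and `f = 1`
on `∂W`, so the minimum of `f` is an interior point, hence critical (Fermat) of index `0` (the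
Hessian at an interior minimum is positive semidefinite), hence the only critical point.
[cite: Milnor1963, §2] -/
theorem ballType_profile {W : Type*} [TopologicalSpace W] [T2Space W]
    [ChartedSpace (EuclideanHalfSpace 4) W] [IsManifold (𝓡∂ 4) ∞ W] [CompactSpace W] [Nonempty W]
    (S : SteinStructure W) {f : W → ℝ} (hf : IsMorseAdapted (𝓡∂ 4) f)
    (hsub : (criticalSet (𝓡∂ 4) f).Subsingleton) :
    (criticalSetOfIndex (𝓡∂ 4) f 0).ncard = 1 ∧ ∀ k, 1 ≤ k → (criticalSetOfIndex (𝓡∂ 4) f k).ncard = 0 := by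
  -- an interior point `q`, where `f q < 1`
  obtain ⟨q, -, hq⟩ :=
    isCompact_univ.exists_isMinOn univ_nonempty S.φ_smooth.continuous.continuousOn
  have hqi : (𝓡∂ 4).IsInteriorPoint q := isInteriorPoint_of_isMinOn_steinφ S hq
  have hfq : f q < 1 := hf.2.2 q hqi
  -- the minimum `p` of `f` is an interior point, hence the unique critical point, of index `0`
  obtain ⟨p, -, hp⟩ :=
    isCompact_univ.exists_isMinOn univ_nonempty hf.isMorse.contMDiff.continuous.continuousOn
  have hpq : f p ≤ f q := hp (mem_univ q)
  have hpi : (𝓡∂ 4).IsInteriorPoint p := by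
    rcases (𝓡∂ 4).isInteriorPoint_or_isBoundaryPoint p with hpi | hpb
    · exact hpi
    · exact absurd ((hf.2.1 p hpb).1 ▸ hpq) (not_le.2 hfq)
  have hplocal : IsLocalMin f p := hp.isLocalMin Filter.univ_mem
  have hpcrit : IsMCriticalPt (𝓡∂ 4) f p := isMCriticalPt_of_isLocalMin hplocal hpi
  haveI : FiniteDimensional ℝ (EuclideanSpace ℝ (Fin 4)) := inferInstance
  have hp0 : morseIndex (𝓡∂ 4) f p = 0 :=
    morseIndex_eq_zero_of_isLocalMin_of_isInteriorPoint
      ((hf.isMorse.contMDiff.of_le (by norm_cast)).contMDiffAt) hplocal hpi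
  have hcrit : criticalSet (𝓡∂ 4) f = {p} := by
    ext x
    simp only [mem_criticalSet, mem_singleton_iff]
    exact ⟨fun hx => hsub hx hpcrit, fun hx => hx ▸ hpcrit⟩
  refine ⟨?_, fun k hk => ?_⟩
  · have he : criticalSetOfIndex (𝓡∂ 4) f 0 = {p} := by
      ext x
      simp only [mem_criticalSetOfIndex, ← mem_criticalSet, hcrit, mem_singleton_iff]
      exact ⟨fun hx => hx.1, fun hx => ⟨hx, by rw [hx, hp0]⟩⟩
    rw [he, ncard_singleton]
  · have he : criticalSetOfIndex (𝓡∂ 4) f k = ∅ := by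
      ext x
      simp only [mem_criticalSetOfIndex, ← mem_criticalSet, hcrit, mem_singleton_iff,
        mem_empty_iff_false, iff_false, not_and]
      intro hx
      rw [hx, hp0]
      omega
    rw [he, ncard_empty]

/-- For an adapted Morse function with indices `≤ 2`, no critical point has index `k ≥ 3`. [folklore] -/
theorem ncard_criticalSetOfIndex_eq_zero_of_le_two {W : Type*} [TopologicalSpace W]
    [ChartedSpace (EuclideanHalfSpace 4) W] {f : W → ℝ}
    (hi : ∀ z, IsMCriticalPt (𝓡∂ 4) f z → morseIndex (𝓡∂ 4) f z ≤ 2) {k : ℕ} (hk : 3 ≤ k) :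
    (criticalSetOfIndex (𝓡∂ 4) f k).ncard = 0 := by
  have he : criticalSetOfIndex (𝓡∂ 4) f k = ∅ := by
    refine eq_empty_of_forall_notMem fun x hx => ?_
    have := hi x hx.1
    rw [hx.2] at this
    omega
  rw [he, ncard_empty]

/-! ### A birth pair on a closed `4`-manifold -/

/-- **Inserting a `(2,3)` birth pair**: a Morse function of profile `(1,0,0,0,1)` on a closed
`4`-manifold can be replaced by one of profile `(1,0,1,1,1)` (Milnor 1965, Lemma 8.2 at a regular
point; a regular point exists since the critical set is finite while `X`, a preconnected Hausdorff
space with two distinct critical points, is infinite). [cite: MilnorHCobordism1965, Lemma 8.2] -/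
theorem exists_isMorse_oneZeroOneOneOne_of_twoPoints {X : Type} [TopologicalSpace X] [T2Space X]
    [CompactSpace X] [ChartedSpace (EuclideanSpace ℝ (Fin 4)) X] [IsManifold (𝓡 4) ∞ X]
    [PreconnectedSpace X] {F : X → ℝ} (hF : IsMorse (𝓡 4) F)
    (h0 : (criticalSetOfIndex (𝓡 4) F 0).ncard = 1) (h1 : (criticalSetOfIndex (𝓡 4) F 1).ncard = 0)
    (h2 : (criticalSetOfIndex (𝓡 4) F 2).ncard = 0) (h3 : (criticalSetOfIndex (𝓡 4) F 3).ncard = 0)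
    (h4 : (criticalSetOfIndex (𝓡 4) F 4).ncard = 1) :
    ∃ G : X → ℝ, IsMorse (𝓡 4) G ∧
      (criticalSetOfIndex (𝓡 4) G 0).ncard = 1 ∧ (criticalSetOfIndex (𝓡 4) G 1).ncard = 0 ∧
      (criticalSetOfIndex (𝓡 4) G 2).ncard = 1 ∧ (criticalSetOfIndex (𝓡 4) G 3).ncard = 1 ∧
      (criticalSetOfIndex (𝓡 4) G 4).ncard = 1 := by
  have hfin : (criticalSet (𝓡 4) F).Finite := IsMorse.finite_criticalSet_holds hF
  have hfin' : ∀ i, (criticalSetOfIndex (𝓡 4) F i).Finite := fun i =>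
    hfin.subset (criticalSetOfIndex_subset _ F i)
  -- two distinct critical points: the minimum (index `0`) and the maximum (index `4`)
  obtain ⟨x₀, hx₀⟩ := Set.ncard_eq_one.1 h0
  obtain ⟨x₄, hx₄⟩ := Set.ncard_eq_one.1 h4
  have hm₀ : x₀ ∈ criticalSetOfIndex (𝓡 4) F 0 := by rw [hx₀]; exact mem_singleton _
  have hm₄ : x₄ ∈ criticalSetOfIndex (𝓡 4) F 4 := by rw [hx₄]; exact mem_singleton _
  have hne : x₀ ≠ x₄ := fun h => by
    have h0' := hm₀.2
    rw [h, hm₄.2] at h0'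
    exact absurd h0' (by norm_num)
  -- a regular point
  obtain ⟨z, hz⟩ : ∃ z, ¬ IsMCriticalPt (𝓡 4) F z := by
    by_contra hall
    push Not at hall
    have huniv : (univ : Set X).Finite := by
      refine hfin.subset fun x _ => ?_
      exact hall x
    haveI : Finite X := finite_univ_iff.1 huniv
    haveI : DiscreteTopology X := Finite.instDiscreteTopology
    haveI : Subsingleton X := ⟨fun a b => isPreconnected_univ.subsingleton (mem_univ a) (mem_univ b)⟩
    exact hne (Subsingleton.elim x₀ x₄)
  obtain ⟨G, hGM, -, -, -, hidx, q, r, -, -, hqr, hq, hr, hcrit, hiq, hir, -⟩ :=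
    hF.exists_insert_birthPair (isInteriorPoint_euclidean z) hz Filter.univ_mem (k := 2)
      (by norm_num) one_pos
  have hmem := mem_criticalSetOfIndex_iff_of_insert hcrit hidx hiq hir hq hr
  refine ⟨G, hGM, ?_, ?_, ?_, ?_, ?_⟩
  · have he : criticalSetOfIndex (𝓡 4) G 0 = criticalSetOfIndex (𝓡 4) F 0 := by
      ext x; rw [hmem]; simp
    rw [he, h0]
  · have he : criticalSetOfIndex (𝓡 4) G 1 = criticalSetOfIndex (𝓡 4) F 1 := by
      ext x; rw [hmem]; simp
    rw [he, h1]
  · have he : criticalSetOfIndex (𝓡 4) G 2 = insert q (criticalSetOfIndex (𝓡 4) F 2) := by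
      ext x; rw [hmem, mem_insert_iff]; simp
    rw [he, Set.ncard_insert_of_notMem (fun hx => hq hx.1) (hfin' 2), h2]
  · have he : criticalSetOfIndex (𝓡 4) G 3 = insert r (criticalSetOfIndex (𝓡 4) F 3) := by
      ext x; rw [hmem, mem_insert_iff]; simp
    rw [he, Set.ncard_insert_of_notMem (fun hx => hr hx.1) (hfin' 3), h3]
  · have he : criticalSetOfIndex (𝓡 4) G 4 = criticalSetOfIndex (𝓡 4) F 4 := by
      ext x; rw [hmem]; simp
    rw [he, h4]

/-! ### The stub -/

/-- **Stub `stub_ballSectorMorse` (the ball sectors, Morse-theoretic half; NEW in skeleton m6).**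
For a crux bisection `X = e₁(W₁) ∪ e₂(W₂)` (two compact contractible Stein domains, smoothly
embedded, covering `X`, meeting exactly along both boundary images, contact planes matched) with
`W₁` of ball type (an adapted Morse function with at most one critical point) and `W₂` smoothly
small (ball type, or Mazur type `(1,1,1)` with indices `≤ 2`), `X` is orientable and carries a
Morse function with exactly `1, 0, 1, 1, 1` critical points of index `0, 1, 2, 3, 4`.  Seam map
(`stub_seam`), Morse gluing across the seam (`SeamGluing.exists_isMorse_of_bisection`), a `(2,3)`
birth pair in the ball × ball case, and orientability of a gluing of orientable pieces along a
connected seam (`exists_isBoundaryGluingWith_connected_isOrientable` + uniqueness of gluings).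
[cite: MilnorHCobordism1965, §1 and Lemma 8.2] [cite: HirschDT1976, Ch. 4 §4 and Ch. 8 §2, Thm. 2.1] -/
theorem stub_ballSectorMorse :
    ∀ (X : Type) [TopologicalSpace X] [T2Space X] [SecondCountableTopology X] [CompactSpace X]
      [ChartedSpace (EuclideanSpace ℝ (Fin 4)) X] [IsManifold (𝓡 4) ∞ X]
      (W₁ : Type) [TopologicalSpace W₁] [ChartedSpace (EuclideanHalfSpace 4) W₁]
      [IsManifold (𝓡∂ 4) ∞ W₁] [CompactSpace W₁] [ContractibleSpace W₁]
      (W₂ : Type) [TopologicalSpace W₂] [ChartedSpace (EuclideanHalfSpace 4) W₂]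
      [IsManifold (𝓡∂ 4) ∞ W₂] [CompactSpace W₂] [ContractibleSpace W₂]
      (J₁ : SteinStructure W₁) (J₂ : SteinStructure W₂) (e₁ : W₁ → X) (e₂ : W₂ → X),
      Manifold.IsSmoothEmbedding (𝓡∂ 4) (𝓡 4) ∞ e₁ → Manifold.IsSmoothEmbedding (𝓡∂ 4) (𝓡 4) ∞ e₂ →
      Set.range e₁ ∪ Set.range e₂ = Set.univ →
      Set.range e₁ ∩ Set.range e₂ = e₁ '' (𝓡∂ 4).boundary W₁ →
      Set.range e₁ ∩ Set.range e₂ = e₂ '' (𝓡∂ 4).boundary W₂ →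
      (∀ w₁ w₂, e₁ w₁ = e₂ w₂ →
        Submodule.map (mfderiv (𝓡∂ 4) (𝓡 4) e₁ w₁).toLinearMap (contactPlane J₁.J w₁) =
          Submodule.map (mfderiv (𝓡∂ 4) (𝓡 4) e₂ w₂).toLinearMap (contactPlane J₂.J w₂)) →
      ∀ (f₁ : W₁ → ℝ), IsMorseAdapted (𝓡∂ 4) f₁ → (criticalSet (𝓡∂ 4) f₁).Subsingleton →
      ∀ (f₂ : W₂ → ℝ), IsMorseAdapted (𝓡∂ 4) f₂ →
      ((criticalSet (𝓡∂ 4) f₂).Subsingleton ∨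
        ((∀ z, IsMCriticalPt (𝓡∂ 4) f₂ z → morseIndex (𝓡∂ 4) f₂ z ≤ 2) ∧
          (criticalSetOfIndex (𝓡∂ 4) f₂ 0).ncard = 1 ∧ (criticalSetOfIndex (𝓡∂ 4) f₂ 1).ncard = 1 ∧
          (criticalSetOfIndex (𝓡∂ 4) f₂ 2).ncard = 1)) →
      IsOrientable (𝓡 4) X ∧
        ∃ F : X → ℝ, IsMorse (𝓡 4) F ∧
          (criticalSetOfIndex (𝓡 4) F 0).ncard = 1 ∧ (criticalSetOfIndex (𝓡 4) F 1).ncard = 0 ∧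
          (criticalSetOfIndex (𝓡 4) F 2).ncard = 1 ∧ (criticalSetOfIndex (𝓡 4) F 3).ncard = 1 ∧
          (criticalSetOfIndex (𝓡 4) F 4).ncard = 1 := by
  intro X _ _ _ _ _ _ W₁ _ _ _ _ _ W₂ _ _ _ _ _ J₁ J₂ e₁ e₂ h1 h2 hcov hL hR hC f₁ hf₁ hb1 f₂ hf₂ hs2
  -- separation, countability, connectedness of the halves
  haveI : T2Space W₁ := h1.isEmbedding.t2Space
  haveI : T2Space W₂ := h2.isEmbedding.t2Space
  haveI : SecondCountableTopology W₁ := h1.isEmbedding.secondCountableTopology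
  haveI : SecondCountableTopology W₂ := h2.isEmbedding.secondCountableTopology
  haveI : ConnectedSpace W₁ := inferInstance
  haveI : ConnectedSpace W₂ := inferInstance
  haveI : Nonempty W₁ := inferInstance
  haveI : Nonempty W₂ := inferInstance
  -- boundary data and the seam diffeomorphism
  obtain ⟨b₁⟩ := nonempty_boundaryData_holds 3 W₁
  obtain ⟨b₂⟩ := nonempty_boundaryData_holds 3 W₂
  obtain ⟨ψ, hψ, -⟩ := LegendrianRKnotRigidity.stub_seam X W₁ W₂ J₁ J₂ e₁ e₂ h1 h2 hL hR hC b₁ b₂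
  haveI : Nonempty b₁.carrier := by
    obtain ⟨x, hx⟩ := J₁.exists_isBoundaryPoint
    have hx' : x ∈ range b₁.incl := by rw [b₁.range_incl]; exact hx
    obtain ⟨z, -⟩ := hx'
    exact ⟨z⟩
  haveI : ConnectedSpace b₁.carrier :=
    Literature.Barriers.SmoothPoincare4.connectedSpace_boundaryCarrier_of_contractibleSpace (n := 2) b₁
  -- `X` is connected (union of two connected pieces meeting in the nonempty seam)
  haveI : PreconnectedSpace X := by
    have hx : ∃ x, x ∈ range e₁ ∩ range e₂ := by
      obtain ⟨z⟩ := (inferInstance : Nonempty b₁.carrier)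
      exact ⟨e₁ (b₁.incl z), ⟨b₁.incl z, rfl⟩, ⟨b₂.incl (ψ z), hψ z⟩⟩
    obtain ⟨x, hx₁, hx₂⟩ := hx
    have hpre : IsPreconnected (range e₁ ∪ range e₂) :=
      (isPreconnected_range h1.contMDiff.continuous).union x hx₁ hx₂
        (isPreconnected_range h2.contMDiff.continuous)
    rw [hcov] at hpre
    exact ⟨hpre⟩
  -- (3) orientability of `X`
  have hXo : IsOrientable (𝓡 4) X := by
    obtain ⟨X₀, _, _, _, _, _, _, _, hX₀o, jM, jN, hW⟩ :=
      exists_isBoundaryGluingWith_connected_isOrientable (n := 3) J₁.isOrientable J₂.isOrientable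
        b₁ b₂ ψ
    have hg : IsBoundaryGluing b₁ b₂ ψ (𝓡 4) X :=
      AcyclicBisectionRigidity.SeamGluing.isBoundaryGluing_of_bisection h1 h2 hcov hL b₁ b₂ ψ hψ
    obtain ⟨Φ⟩ := nonempty_diffeomorph_of_isBoundaryGluing_holds hW.isBoundaryGluing hg
    exact hX₀o.of_diffeomorph Φ (by simp)
  refine ⟨hXo, ?_⟩
  -- (1) profiles of the halves
  obtain ⟨h10, h1k⟩ := ballType_profile J₁ hf₁ hb1
  -- (2) Morse gluing across the seam
  obtain ⟨F, hF, hcount⟩ :=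
    AcyclicBisectionRigidity.SeamGluing.exists_isMorse_of_bisection h1 h2 hcov hL b₁ b₂ ψ hψ hf₁ hf₂
  rcases hs2 with hb2 | ⟨hi2, h20, h21, h22⟩
  · -- ball × ball: profile `(1,0,0,0,1)`, then a `(2,3)` birth pair
    obtain ⟨h20, h2k⟩ := ballType_profile J₂ hf₂ hb2
    have c0 : (criticalSetOfIndex (𝓡 4) F 0).ncard = 1 := by
      rw [hcount 0 4 rfl, h10, h2k 4 (by norm_num)]
    have c1 : (criticalSetOfIndex (𝓡 4) F 1).ncard = 0 := by
      rw [hcount 1 3 rfl, h1k 1 le_rfl, h2k 3 (by norm_num)]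
    have c2 : (criticalSetOfIndex (𝓡 4) F 2).ncard = 0 := by
      rw [hcount 2 2 rfl, h1k 2 (by norm_num), h2k 2 (by norm_num)]
    have c3 : (criticalSetOfIndex (𝓡 4) F 3).ncard = 0 := by
      rw [hcount 3 1 rfl, h1k 3 (by norm_num), h2k 1 le_rfl]
    have c4 : (criticalSetOfIndex (𝓡 4) F 4).ncard = 1 := by
      rw [hcount 4 0 rfl, h1k 4 (by norm_num), h20]
    exact exists_isMorse_oneZeroOneOneOne_of_twoPoints hF c0 c1 c2 c3 c4
  · -- ball × Mazur: profile `(1,0,1,1,1)` directly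
    refine ⟨F, hF, ?_, ?_, ?_, ?_, ?_⟩
    · rw [hcount 0 4 rfl, h10, ncard_criticalSetOfIndex_eq_zero_of_le_two hi2 (by norm_num)]
    · rw [hcount 1 3 rfl, h1k 1 le_rfl, ncard_criticalSetOfIndex_eq_zero_of_le_two hi2 le_rfl]
    · rw [hcount 2 2 rfl, h1k 2 (by norm_num), h22]
    · rw [hcount 3 1 rfl, h1k 3 (by norm_num), h21]
    · rw [hcount 4 0 rfl, h1k 4 (by norm_num), h20]

end Summit.SmoothPoincare4.SmoothPoincare4.Theorems.ContractibleTwistedDoubleStandard.PropertyRMazurHalves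

end
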